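import Literature.Topology.FourManifolds.CoupleRigidity
import Literature.Topology.FourManifolds.HandleFeet
import Literature.Topology.FourManifolds.BoundaryOrientation

/-!
# Calculus for the entrance transition: the Jacobian of the cone of a sphere diffeomorphism,
# the entrance sheet at its centre, the quadratic form

Topic `Literature/Topology/FourManifolds` (support of `stmt-SmoothPoincare4-15190`, structure
conjugacy; Euclidean calculus used to pass from the `3`-dimensional orientation law of
`EntranceSheetLaw.lean` to the `2`-dimensional transition maps of the unit entrance charts).
Everything here is **proved**.

* `pos_iff_pos_of_isPreconnected` — a continuous nowhere-vanishing real function on a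
  preconnected set has one sign (intermediate value theorem);
* `TracePolar.det_fderiv_sphereCone_pos_iff` — **the Jacobian determinant of the cone
  `sphereCone φ` of a diffeomorphism `φ` of `S²` has one sign on `ℝ³ ∖ {0}`** (it is continuous
  and non-zero there, and `ℝ³ ∖ {0}` is connected);
* `TracePolar.entPoint_eq_consCLE`, `TracePolar.hasFDerivAt_entPoint_zero` — the entrance sheet
  `y ↦ (±√(ε² + ‖y‖²); y)` is `consCLE 2 (y, ±√…)` and its differential at the centre `y = 0` is
  the inclusion `consZeroL 2 : y ↦ (0; y)` of `BoundaryOrientation.lean`;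
* `TracePolar.hasFDerivAt_milnorQuadratic_one_of_yv_eq_zero` — on the axis `y⃗ = 0` the
  differential of `Q₁(u) = -u₀² + ‖y⃗‖²` is `v ↦ -2 u₀ v₀`.

## References

* J. Milnor, *Lectures on the h-cobordism theorem* (1965), Def. 3.1, proof of Thm. 3.12.
  [MilnorHCobordism1965]
* M. W. Hirsch, *Differential Topology* (1976), Ch. 4 §4. [HirschDT1976]
-/

open scoped Manifold ContDiff Topology
open Set Function Filter Metric Module

noncomputable section

namespace Literature.Topology.FourManifolds

/-! ### One sign on preconnected sets -/

/-- **A continuous nowhere-vanishing real function on a preconnected set has one sign.** [folklore] -/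
theorem pos_iff_pos_of_isPreconnected {X : Type*} [TopologicalSpace X] {S : Set X} (hS : IsPreconnected S)
    {d : X → ℝ} (hd : ContinuousOn d S) (h0 : ∀ x ∈ S, d x ≠ 0) {x x' : X} (hx : x ∈ S) (hx' : x' ∈ S) :
    0 < d x ↔ 0 < d x' := by
  rcases lt_or_gt_of_ne (h0 x hx) with hneg | hpos
  · rcases lt_or_gt_of_ne (h0 x' hx') with hneg' | hpos'
    · exact iff_of_false (not_lt.2 hneg.le) (not_lt.2 hneg'.le)
    · exfalso
      obtain ⟨z, hz, hdz⟩ := hS.intermediate_value hx hx' hd ⟨hneg.le, hpos'.le⟩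
      exact h0 z hz hdz
  · rcases lt_or_gt_of_ne (h0 x' hx') with hneg' | hpos'
    · exfalso
      obtain ⟨z, hz, hdz⟩ := hS.intermediate_value hx' hx hd ⟨hneg'.le, hpos.le⟩
      exact h0 z hz hdz
    · exact iff_of_true hpos hpos'

namespace TracePolar

attribute [local instance] fact_finrank_euclideanSpace_succ

/-- Local notation for the model plane and space. -/
local notation "E2" => EuclideanSpace ℝ (Fin 2)
local notation "E3" => EuclideanSpace ℝ (Fin 3)

/-! ### The Jacobian of the cone of a sphere diffeomorphism -/

variable (φ : Metric.sphere (0 : E3) 1 ≃ₘ⟮𝓡 2, 𝓡 2⟯ Metric.sphere (0 : E3) 1)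

/-- The cone of a smooth map of the sphere is `C^∞` on `ℝ³ ∖ {0}`. [folklore] -/
theorem contDiffOn_sphereCone : ContDiffOn ℝ ∞ (sphereCone φ) {w : E3 | w ≠ 0} := fun _ hw =>
  (contDiffAt_sphereCone φ.contMDiff hw).contDiffWithinAt

/-- The Jacobian determinant of the cone, as a function. [folklore] -/
def coneJac (w : E3) : ℝ := LinearMap.det ((fderiv ℝ (sphereCone φ) w : E3 →L[ℝ] E3) : E3 →ₗ[ℝ] E3)

/-- Unfolding `coneJac`. [folklore] -/
theorem coneJac_def (w : E3) : coneJac φ w = LinearMap.det ((fderiv ℝ (sphereCone φ) w : E3 →L[ℝ] E3) : E3 →ₗ[ℝ] E3) := rfl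

/-- **The Jacobian of the cone does not vanish off the origin** (the cone of `φ⁻¹` inverts it). [folklore] -/
theorem coneJac_ne_zero {w : E3} (hw : w ≠ 0) : coneJac φ w ≠ 0 := by
  have hS : HasFDerivAt (sphereCone φ) (fderiv ℝ (sphereCone φ) w) w :=
    ((contDiffAt_sphereCone φ.contMDiff hw).differentiableAt (by simp)).hasFDerivAt
  have hw' : sphereCone φ w ≠ 0 := by rw [← norm_ne_zero_iff, norm_sphereCone]; exact norm_ne_zero_iff.2 hw
  have hS' : HasFDerivAt (sphereCone φ.symm) (fderiv ℝ (sphereCone φ.symm) (sphereCone φ w)) (sphereCone φ w) :=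
    ((contDiffAt_sphereCone φ.symm.contMDiff hw').differentiableAt (by simp)).hasFDerivAt
  have hcomp := hS'.comp w hS
  have hid : (sphereCone φ.symm ∘ sphereCone φ) = id := funext fun v => sphereCone_sphereCone φ.symm_apply_apply v
  rw [hid] at hcomp
  have heq := hcomp.unique (hasFDerivAt_id w)
  intro h0
  have h1 : LinearMap.det (((fderiv ℝ (sphereCone φ.symm) (sphereCone φ w)).comp (fderiv ℝ (sphereCone φ) w) : E3 →L[ℝ] E3) :
      E3 →ₗ[ℝ] E3) = 0 := by
    have h2 : (((fderiv ℝ (sphereCone φ.symm) (sphereCone φ w)).comp (fderiv ℝ (sphereCone φ) w) : E3 →L[ℝ] E3) : E3 →ₗ[ℝ] E3) =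
        ((fderiv ℝ (sphereCone φ.symm) (sphereCone φ w) : E3 →L[ℝ] E3) : E3 →ₗ[ℝ] E3).comp
          ((fderiv ℝ (sphereCone φ) w : E3 →L[ℝ] E3) : E3 →ₗ[ℝ] E3) := rfl
    rw [h2, LinearMap.det_comp]
    have h3 : LinearMap.det ((fderiv ℝ (sphereCone φ) w : E3 →L[ℝ] E3) : E3 →ₗ[ℝ] E3) = 0 := h0
    rw [h3, mul_zero]
  rw [heq] at h1
  have h4 : LinearMap.det ((ContinuousLinearMap.id ℝ E3 : E3 →L[ℝ] E3) : E3 →ₗ[ℝ] E3) = 1 := by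
    rw [ContinuousLinearMap.coe_id, LinearMap.det_id]
  rw [h4] at h1
  exact one_ne_zero h1

/-- **The Jacobian of the cone is continuous off the origin.** [folklore] -/
theorem continuousOn_coneJac : ContinuousOn (coneJac φ) {w : E3 | w ≠ 0} := by
  have h1 : ContinuousOn (fderiv ℝ (sphereCone φ)) {w : E3 | w ≠ 0} :=
    (contDiffOn_sphereCone φ).continuousOn_fderiv_of_isOpen isOpen_ne (by simp)
  exact (ContinuousLinearMap.continuous_det.comp_continuousOn h1)

/-- **The Jacobian determinant of the cone of a sphere diffeomorphism has one sign on `ℝ³ ∖ {0}`.** [cite: HirschDT1976, Ch. 4 §4] -/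
theorem coneJac_pos_iff {w w' : E3} (hw : w ≠ 0) (hw' : w' ≠ 0) : 0 < coneJac φ w ↔ 0 < coneJac φ w' := by
  have hrank : 1 < Module.rank ℝ E3 := by
    rw [← Module.finrank_eq_rank, finrank_euclideanSpace_fin]; norm_num
  have hconn : IsPreconnected ({(0 : E3)}ᶜ : Set E3) := (isConnected_compl_singleton_of_one_lt_rank hrank 0).isPreconnected
  have heq : ({(0 : E3)}ᶜ : Set E3) = {w : E3 | w ≠ 0} := by ext v; simp
  rw [heq] at hconn
  exact pos_iff_pos_of_isPreconnected hconn (continuousOn_coneJac φ) (fun v hv => coneJac_ne_zero φ hv) hw hw'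

/-! ### The entrance sheet at its centre -/

/-- **The entrance-sheet point is `consCLE 2 (y, ±√(ε² + ‖y‖²))`** (first coordinate last in the pair). [folklore] -/
theorem entPoint_eq_consCLE (ε : ℝ) (b : Bool) (y : E2) :
    entPoint ε b y = BoundaryManifold.consCLE 2 (y, boolSign b * Real.sqrt (ε ^ 2 + ‖y‖ ^ 2)) := by
  ext i
  fin_cases i
  · rfl
  · show entPoint ε b y 1 = BoundaryManifold.consCLE 2 (y, _) (Fin.succ 0); rw [BoundaryManifold.consCLE_apply_succ]; rfl
  · show entPoint ε b y 2 = BoundaryManifold.consCLE 2 (y, _) (Fin.succ 1); rw [BoundaryManifold.consCLE_apply_succ]; rfl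

/-- The radial factor `√(ε² + ‖y‖²)` has vanishing differential at `y = 0`. [folklore] -/
theorem hasFDerivAt_sqrt_sq_add_norm_sq_zero {ε : ℝ} (hε : ε ≠ 0) :
    HasFDerivAt (fun y : E2 => Real.sqrt (ε ^ 2 + ‖y‖ ^ 2)) (0 : E2 →L[ℝ] ℝ) 0 := by
  have h1 : HasFDerivAt (fun y : E2 => ‖y‖ ^ 2) (0 : E2 →L[ℝ] ℝ) 0 := by
    have h := (hasStrictFDerivAt_norm_sq (0 : E2)).hasFDerivAt
    rw [map_zero, smul_zero] at h
    exact h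
  have h2 : HasFDerivAt (fun y : E2 => ε ^ 2 + ‖y‖ ^ 2) (0 : E2 →L[ℝ] ℝ) 0 := by
    exact h1.const_add (ε ^ 2)
  have h3 : HasDerivAt Real.sqrt (1 / (2 * Real.sqrt (ε ^ 2 + ‖(0 : E2)‖ ^ 2))) (ε ^ 2 + ‖(0 : E2)‖ ^ 2) :=
    Real.hasDerivAt_sqrt (by rw [norm_zero]; positivity)
  have h4 := h3.comp_hasFDerivAt (0 : E2) h2
  rw [smul_zero] at h4
  exact h4

/-- **The differential of the entrance sheet at its centre is the inclusion `y ↦ (0; y)`.** [cite: MilnorHCobordism1965, proof of Thm. 3.12] -/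
theorem hasFDerivAt_entPoint_zero {ε : ℝ} (hε : ε ≠ 0) (b : Bool) : HasFDerivAt (entPoint ε b) (consZeroL 2) (0 : E2) := by
  have hfun : entPoint ε b = fun y : E2 => BoundaryManifold.consCLE 2 (y, boolSign b * Real.sqrt (ε ^ 2 + ‖y‖ ^ 2)) :=
    funext (entPoint_eq_consCLE ε b)
  rw [hfun]
  have h1 : HasFDerivAt (fun y : E2 => boolSign b * Real.sqrt (ε ^ 2 + ‖y‖ ^ 2)) (0 : E2 →L[ℝ] ℝ) 0 := by
    have := (hasFDerivAt_sqrt_sq_add_norm_sq_zero hε).const_mul (boolSign b); simpa using this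
  have h2 : HasFDerivAt (fun y : E2 => (y, boolSign b * Real.sqrt (ε ^ 2 + ‖y‖ ^ 2)))
      ((ContinuousLinearMap.id ℝ E2).prod (0 : E2 →L[ℝ] ℝ)) 0 := (hasFDerivAt_id (0 : E2)).prodMk h1
  have h3 := ((BoundaryManifold.consCLE 2 : (E2 × ℝ) ≃L[ℝ] E3) : (E2 × ℝ) →L[ℝ] E3).hasFDerivAt.comp (0 : E2) h2
  have heq : ((BoundaryManifold.consCLE 2 : (E2 × ℝ) ≃L[ℝ] E3) : (E2 × ℝ) →L[ℝ] E3).comp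
      ((ContinuousLinearMap.id ℝ E2).prod (0 : E2 →L[ℝ] ℝ)) = consZeroL 2 := by
    ext y : 1
    rfl
  rw [heq] at h3
  exact h3

/-- The inclusion `consZeroL 2` in the model coordinates: `consZeroL 2 y = (0; y)`. [folklore] -/
theorem consZeroL_two_eq_mk3 (y : E2) : consZeroL 2 y = mk3 0 y := by
  ext i
  fin_cases i
  · rfl
  · show BoundaryManifold.consCLE 2 (y, (0 : ℝ)) (Fin.succ 0) = mk3 0 y 1; rw [BoundaryManifold.consCLE_apply_succ]; rfl
  · show BoundaryManifold.consCLE 2 (y, (0 : ℝ)) (Fin.succ 1) = mk3 0 y 2; rw [BoundaryManifold.consCLE_apply_succ]; rfl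

/-! ### The quadratic form on the axis -/

/-- **On the axis `y⃗ = 0` the differential of `Q₁(u) = -u₀² + ‖y⃗‖²` is `v ↦ -2 u₀ v₀`.** [cite: MilnorHCobordism1965, Def. 3.1] -/
theorem hasFDerivAt_milnorQuadratic_one_of_yv_eq_zero {u : E3} (hu : yv u = 0) :
    HasFDerivAt (milnorQuadratic 1 : E3 → ℝ) ((-2 * u 0) • (EuclideanSpace.proj (0 : Fin 3) : E3 →L[ℝ] ℝ)) u := by
  have hfun : (milnorQuadratic 1 : E3 → ℝ) = fun u => -(u 0) ^ 2 + ‖yv u‖ ^ 2 := funext milnorQuadratic_one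
  rw [hfun]
  -- `u ↦ u 0`
  have h0 : HasFDerivAt (fun u : E3 => u 0) (EuclideanSpace.proj (0 : Fin 3) : E3 →L[ℝ] ℝ) u :=
    (EuclideanSpace.proj (0 : Fin 3) : E3 →L[ℝ] ℝ).hasFDerivAt
  have h1 : HasFDerivAt (fun u : E3 => -(u 0) ^ 2) ((-2 * u 0) • (EuclideanSpace.proj (0 : Fin 3) : E3 →L[ℝ] ℝ)) u := by
    have h := (h0.mul h0).neg
    refine h.congr_fderiv ?_ |>.congr_of_eventuallyEq ?_
    · ext v
      simp only [neg_apply, add_apply, smul_apply, smul_eq_mul, neg_mul]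
      ring
    · exact Eventually.of_forall fun v => by simp [sq]
  -- `u ↦ ‖yv u‖²` has vanishing differential where `yv u = 0`
  have hyv : HasFDerivAt (yv : E3 → E2) (fderiv ℝ yv u) u := (contDiff_yv.differentiable (by simp) u).hasFDerivAt
  have h2 : HasFDerivAt (fun u : E3 => ‖yv u‖ ^ 2) (0 : E3 →L[ℝ] ℝ) u := by
    have hn : HasFDerivAt (fun y : E2 => ‖y‖ ^ 2) (0 : E2 →L[ℝ] ℝ) (yv u) := by
      have h := (hasStrictFDerivAt_norm_sq (yv u)).hasFDerivAt
      rw [hu] at h ⊢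
      rw [map_zero, smul_zero] at h
      exact h
    have h5 := hn.comp u hyv
    rw [ContinuousLinearMap.zero_comp] at h5
    exact h5
  have h3 := h1.add h2
  rw [add_zero] at h3
  exact h3

end TracePolar

end Literature.Topology.FourManifolds
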